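import Summits.HodgeConjecture.CorCM.MultiFieldWeilCurveAbsorption
import Summits.HodgeConjecture.CorCM.MultiFieldWeilAnyTwoSimpleDimLeThreeForeignCurve
import Summits.HodgeConjecture.CorCM.MultiFieldWeilTwoSimpleThreefolds
import Summits.HodgeConjecture.CorCM.MultiFieldWeilTwoThreefoldsForeignCurve
import Summits.HodgeConjecture.CorCM.SimpleCMThreefoldPairsHodge
import Summits.HodgeConjecture.CorCM.CMEllipticCurveTimesSimpleCMThreefold
import HarnessLib

/-!
# MULTI-FIELD WEIL ENGINE — ANY TWO SIMPLE CM THREEFOLDS AND ANY CM ELLIPTIC CURVE: the Hodge conjecture for every `T₀^a × T₁^b × E′^c`, given ONLY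
# Markman's fourfold theorem (the mixed case by CURVE ABSORPTION)

Cell `pub-hodgecm2` (COR-CM), seat b30 gen 34 (2026-08-24); count-neutral own lane MULTI-FIELD WEIL ENGINE (stem `MultiFieldWeil*`), sequel of
`CorCM/MultiFieldWeilCurveAbsorption.lean` (a CM elliptic curve whose field embeds in a sextic member field adds nothing to the Mumford–Tate rank of any family
containing that member).  Theorems only; no definition, no named fact, no `sorry`.  HONEST FRAMING: conditional on the displayed Markman fourfold binder only;
`HC_CM` is NOT proved and not asserted.

THE STATEMENT (**`hodgeConjectureFor_biproduct_comp_vec_of_any_two_simpleThreefolds_cmCurve_of_markman`**).  `T₀ ⊨ (K₀; Φ₀)`, `T₁ ⊨ (K₁; Φ₁)` ANY two SIMPLE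
complex abelian threefolds with complex multiplication (sextic CM fields `K₀`, `K₁`), `E′ ⊨ (k′; Ψ′)` ANY CM elliptic curve — NOTHING assumed on the three fields, on
the types, or on the relation between the threefolds.  Then for every `κ : Fin N → Fin 3` — every `T₀^a × T₁^b × E′^c` in any number and order — the Hodge
conjecture holds for `⨁_j ![T₀, T₁, E′] (κ j)`, GIVEN ONLY `Markman2025_weilClasses_algebraic_abelianFourfold`; with the dominated ∕ isogenous forms.  Gen 33
(`WHAT-IS-KNOWN-g33.md`, honest limits) had this exactly in the two cases `k′ ↪ K₀, K₁` BOTH (gen 31's G4 `…two_simpleThreefolds_of_markman`) and NEITHER (S6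
`…any_two_simple_dim_le_three_foreignCurve_of_markman`) and listed the MIXED case `k′ ↪ K₀`, `k′ ↪̸ K₁` as open, p2's slot criterion being silent in the sister
configuration `K₀ = k′·F`, `K₁ = k₁·F` (`k₁ = ℚ(√(−d′·disc F))`, the two sextic slots share the constituent `χ_{k′} ⊗ std_F`).

THE MIXED CASE (§1, **`hodgeConjectureFor_biproduct_comp_vec_of_two_simpleThreefolds_absorbedCurve_of_markman`**), by CURVE ABSORPTION instead of a slot
criterion.  If `T₀ ∼ T₁` everything is a product of copies of `T₀`, `E′` up to isogeny (gen 31's G6).  Otherwise the blocks `{T₀, E′} ∣ {T₁}` are ADDITIVE —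
`rank(T₀ T₁ E′) + 2 = rank(T₀ E′) + rank(T₁) + 1`, i.e. `Hg(T₀^a × T₁^b × E′^c) = Hg(T₀^a × E′^c) × Hg(T₁^b)` — because
* `rank(T₀ T₁ E′) = rank(T₀ T₁)` and `rank(T₀ E′) = rank(T₀)`: the curve is ABSORBED by `T₀` (`[K₀ : ℚ]/2 = 3` is odd; `cmFamilyRank_comp_eq_of_quadratic_slot_of_odd`);
* `rank(T₀ T₁) = rank(T₀) + rank(T₁) − 1 = 4 + 4 − 1`: `K₀`, `K₁` share NO imaginary quadratic field (the only one of `K₀` is `k′`, a sextic field having at most one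
  quadratic subfield — b16's `WeilFibre.nonempty_algEquiv_of_finrank_eq_two` —, and `k′ ↪̸ K₁`), so the pair is nondegenerate by b16's census
  `isNondegenerateFamily_simpleThreefolds_iff`;
and b16's block gluing `hodgeConjectureFor_biproduct_of_cmFamilyRank_fiber_add_card_eq` assembles gen 31's G6 (`T₀ × E′`, ANY CM curve × ANY simple CM threefold, mod
Markman) with the powers of `T₁` (Moonen–Zarhin (5.2), unconditional).  The exceptional Hodge classes of these products therefore all come from the fourfolds
`T₀ × E′` (Weil classes, Moonen–Zarhin (0.1) (a)); none is new.

[cite: MoonenZarhin1999LowDim, Thm. (0.1) (a), Thm. (0.2), §3 (3.1), §5 (5.2)] [cite: Markman2025SurveySecant, Thm. 1.2] [cite: Gordon1999HodgeAVSurvey, §3 Theorem (proof), 7.4–7.7]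
[cite: Shimura1998, §6.1 Corollary of Theorem 2 (p. 41), §18.1] [cite: MumfordAV1970, §19 Thm. 1 and p. 169]

## References
* [MoonenZarhin1999LowDim] B. Moonen, Yu. Zarhin, Math. Ann. 315 (1999) 711–733.  [Markman2025SurveySecant] E. Markman, arXiv:2509.23403, Thm. 1.2.
  [Gordon1999HodgeAVSurvey] B. B. Gordon, *A survey of the Hodge conjecture for abelian varieties*, §3, 7.4–7.7.  [Shimura1998] G. Shimura, *Abelian varieties with
  complex multiplication and modular functions*, §6.1, §18.1.  [MumfordAV1970] D. Mumford, *Abelian Varieties*, §19.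
-/

noncomputable section

open CategoryTheory CategoryTheory.Limits NumberField IntermediateField

namespace Summit.HodgeConjecture.CorCM.MultiFieldWeil

open Literature.AlgebraicGeometry Literature.AlgebraicGeometry.Motives Literature.AlgebraicGeometry.HodgeTheory
open Literature.AlgebraicGeometry.ComplexMultiplication (IsCMTypeRealisation)
open Literature.AlgebraicTopology.SingularHomology
open Literature.NumberTheory.ComplexMultiplication
open Literature.AlgebraicGeometry.Pohlmann1968 (IsNondegenerate)
open Literature.AlgebraicGeometry.Pohlmann1968.CMAlgebra

open scoped Classical

section TwoThreefoldsCurve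

variable {K₀ K₁ k' : Type} [Field K₀] [NumberField K₀] [IsCMField K₀] [Field K₁] [NumberField K₁] [IsCMField K₁] [Field k'] [NumberField k'] [IsCMField k']
  {N : ℕ} {T₀ T₁ E' : AbelianVariety ℂ} {Φ₀ : CMType K₀} {Φ₁ : CMType K₁} {Ψ' : CMType k'}
  {ι₀ : 𝓞 K₀ →+* End T₀} {θ₀ : K₀ →+* Module.End ℂ (complexBetti T₀.X 1)}
  {ι₁ : 𝓞 K₁ →+* End T₁} {θ₁ : K₁ →+* Module.End ℂ (complexBetti T₁.X 1)}
  {ιE' : 𝓞 k' →+* End E'} {θE' : k' →+* Module.End ℂ (complexBetti E'.X 1)}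

/-! ## §1 The mixed case `k′ ↪ K₀`, `k′ ↪̸ K₁`: the blocks `{T₀, E′} ∣ {T₁}` are additive by curve absorption -/

omit [IsCMField K₀] [NumberField K₁] [IsCMField K₁] [IsCMField k'] in
/-- **A sextic field through `k′` shares no imaginary quadratic field with a field avoiding `k′`**: every quadratic subfield of `K₀ ⊇ i₀(k′)` is isomorphic to `k′`
(a field of degree not divisible by `4` has at most one quadratic subfield, b16's `WeilFibre.nonempty_algEquiv_of_finrank_eq_two`), so it does not embed in `K₁`.
[cite: Shimura1998, §18.1] [cite: Lang2002, VI §1 Thm. 1.1] -/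
theorem not_exists_quadratic_ringHom_of_isEmpty (h2' : Module.finrank ℚ k' = 2) (h6₀ : Module.finrank ℚ K₀ = 6) (i₀ : k' →+* K₀)
    (h₁ : IsEmpty (k' →+* K₁)) : ¬ ∃ F : IntermediateField ℚ K₀, Module.finrank ℚ F = 2 ∧ IsTotallyComplex F ∧ Nonempty (F →+* K₁) := by
  rintro ⟨F, hF2, -, ⟨j⟩⟩
  obtain ⟨e⟩ := WeilFibre.nonempty_algEquiv_of_finrank_eq_two (M := K₀) h2' hF2 (by rw [h6₀]; decide) i₀.toRatAlgHom F.val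
  exact h₁.false (j.comp e.toRingEquiv.toRingHom)

/-- **THE MIXED CASE.**  `T₀ ⊨ (K₀; Φ₀)`, `T₁ ⊨ (K₁; Φ₁)` simple CM threefolds (sextic fields), `E′ ⊨ (k′; Ψ′)` a CM elliptic curve with `i₀ : k′ ↪ K₀` and `k′ ↪̸ K₁`.  Then
for every `κ : Fin N → Fin 3` the Hodge conjecture holds for `⨁_j ![T₀, T₁, E′] (κ j)`, GIVEN ONLY Markman's fourfold theorem.  `T₀ ∼ T₁`: a product of copies of
`T₀, E′` up to isogeny (gen 31's G6).  `T₀ ≁ T₁`: `rank(T₀ T₁ E′) = rank(T₀ T₁) = 7` (curve absorption; b16's census of pairs — no shared imaginary quadratic field),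
`rank(T₀ E′) = rank(T₀) = 4` (absorption), `rank(T₁) = 4`; so `rank + 2 = 4 + 4 + 1` over the blocks `{T₀, E′} ∣ {T₁}` and b16's block gluing assembles G6 with the
powers of `T₁`. [cite: MoonenZarhin1999LowDim, Thm. (0.1) (a), §3 (3.1), §5 (5.2)] [cite: Markman2025SurveySecant, Thm. 1.2] [cite: Gordon1999HodgeAVSurvey, §3 Theorem (proof), 7.5–7.7] -/
theorem hodgeConjectureFor_biproduct_comp_vec_of_two_simpleThreefolds_absorbedCurve_of_markman (hW4 : Markman2025_weilClasses_algebraic_abelianFourfold)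
    (h6₀ : Module.finrank ℚ K₀ = 6) (h6₁ : Module.finrank ℚ K₁ = 6) (h2' : Module.finrank ℚ k' = 2) (hT₀ : IsCMTypeRealisation Φ₀ T₀ ι₀ θ₀)
    (hT₁ : IsCMTypeRealisation Φ₁ T₁ ι₁ θ₁) (hE' : IsCMTypeRealisation Ψ' E' ιE' θE') (hS₀ : T₀.IsSimple) (hS₁ : T₁.IsSimple) (i₀ : k' →+* K₀)
    (h₁ : IsEmpty (k' →+* K₁)) (κ : Fin N → Fin 3) :
    HodgeConjectureFor (⨁ fun j => (![T₀, T₁, E'] : Fin 3 → AbelianVariety ℂ) (κ j)).dim (⨁ fun j => (![T₀, T₁, E'] : Fin 3 → AbelianVariety ℂ) (κ j)).X := by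
  -- `T₀ ∼ T₁`: a product of copies of `E', T₀` up to isogeny
  by_cases hiso : AbelianVariety.IsIsogenous T₀ T₁
  · refine hodgeConjectureFor_of_isIsogenous_biproduct_comp_of_cmCurve_simpleThreefold_of_markman hW4 h2' h6₀ hE' hT₀ hS₀
      (fun j => (![1, 1, 0] : Fin 3 → Fin 2) (κ j)) (AbelianVariety.IsIsogenous.biproduct fun j => ?_)
    show AbelianVariety.IsIsogenous ((![T₀, T₁, E'] : Fin 3 → AbelianVariety ℂ) (κ j))
      ((![E', T₀] : Fin 2 → AbelianVariety ℂ) ((![1, 1, 0] : Fin 3 → Fin 2) (κ j)))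
    generalize κ j = c
    fin_cases c
    · exact AbelianVariety.IsIsogenous.refl T₀
    · exact hiso.symm'
    · exact AbelianVariety.IsIsogenous.refl E'
  -- dimensions and nondegeneracy of the two threefold types
  have h3₀ : T₀.dim ≤ 3 := by rw [AndreProductForm.dim_eq_of_isCMTypeRealisation hT₀, h6₀]
  have h3₁ : T₁.dim ≤ 3 := by rw [AndreProductForm.dim_eq_of_isCMTypeRealisation hT₁, h6₁]
  -- the family of fields `(K₀, K₁, k')` with its instances (all identifications below are definitional)
  let Kf : Fin 3 → Type := Fin.cons K₀ (Fin.cons K₁ (Fin.cons k' finZeroElim))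
  letI instF : ∀ j, Field (Kf j) := Fin.cons ‹Field K₀› (Fin.cons ‹Field K₁› (Fin.cons ‹Field k'› finZeroElim))
  letI instN : ∀ j, NumberField (Kf j) := Fin.cons ‹NumberField K₀› (Fin.cons ‹NumberField K₁› (Fin.cons ‹NumberField k'› finZeroElim))
  haveI instC : ∀ j, IsCMField (Kf j) := Fin.cons ‹IsCMField K₀› (Fin.cons ‹IsCMField K₁› (Fin.cons ‹IsCMField k'› finZeroElim))
  let Φf : ∀ j : Fin 3, CMType (Kf j) := Fin.cons Φ₀ (Fin.cons Φ₁ (Fin.cons Ψ' finZeroElim))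
  let ιf : ∀ j : Fin 3, 𝓞 (Kf j) →+* End ((![T₀, T₁, E'] : Fin 3 → AbelianVariety ℂ) j) := Fin.cons ι₀ (Fin.cons ι₁ (Fin.cons ιE' finZeroElim))
  let θf : ∀ j : Fin 3, Kf j →+* Module.End ℂ (complexBetti ((![T₀, T₁, E'] : Fin 3 → AbelianVariety ℂ) j).X 1) :=
    Fin.cons θ₀ (Fin.cons θ₁ (Fin.cons θE' finZeroElim))
  have hA : ∀ j, IsCMTypeRealisation (Φf j) ((![T₀, T₁, E'] : Fin 3 → AbelianVariety ℂ) j) (ιf j) (θf j) :=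
    Fin.cons hT₀ (Fin.cons hT₁ (Fin.cons hE' finZeroElim))
  have hnd₀ : IsNondegenerate (Φf 0) := isNondegenerate_of_isSimple_of_dim_le_three_slot hA (b := 0) hS₀ h3₀
  have hnd₁ : IsNondegenerate (Φf 1) := isNondegenerate_of_isSimple_of_dim_le_three_slot hA (b := 1) hS₁ h3₁
  have h2f : Module.finrank ℚ (Kf 2) = 2 := h2'
  have hodd : ¬ 2 ∣ Module.finrank ℚ (Kf 0) / 2 := by
    rw [show Module.finrank ℚ (Kf 0) = 6 from h6₀]
    decide
  -- (a) the pair `(T₀, T₁)` is nondegenerate: rank `7`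
  have hpair : cmFamilyRank (fun j : Fin 2 => Φf (Fin.castSucc j)) = 7 := by
    have hI : ∀ j : Fin 2, j = 0 ∨ j = 1 := fun j => by fin_cases j <;> simp
    have hnd := (isNondegenerateFamily_simpleThreefolds_iff (Φ := fun j : Fin 2 => Φf (Fin.castSucc j))
      (A := fun j => (![T₀, T₁, E'] : Fin 3 → AbelianVariety ℂ) (Fin.castSucc j)) (ι := fun j => ιf (Fin.castSucc j))
      (θ := fun j => θf (Fin.castSucc j)) (i₀ := (0 : Fin 2)) (i₁ := 1) zero_ne_one hI ?_ (fun j => hA (Fin.castSucc j)) ?_ ?_).2 ?_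
    · rw [isNondegenerateFamily_iff, Fin.sum_univ_two] at hnd
      rw [hnd, show Module.finrank ℚ (Kf (Fin.castSucc 0)) = 6 from h6₀, show Module.finrank ℚ (Kf (Fin.castSucc 1)) = 6 from h6₁]
      decide
    · intro j
      fin_cases j
      · exact h6₀
      · exact h6₁
    · intro j
      fin_cases j
      · exact hS₀
      · exact hS₁
    · intro i j hij
      fin_cases i <;> fin_cases j
      · exact absurd rfl hij
      · exact hiso
      · exact fun h => hiso h.symm'
      · exact absurd rfl hij
    · exact not_exists_quadratic_ringHom_of_isEmpty h2' h6₀ i₀ h₁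
  -- (b) the curve is absorbed by `T₀`: rank of the whole family `= 7`
  have hrank : cmFamilyRank Φf = 7 := by
    rw [← hpair]
    refine (cmFamilyRank_comp_eq_of_quadratic_slot_of_odd Φf (i₀ := 2) h2f Fin.castSucc (fun i hi => ?_) 0 i₀ hodd).symm
    fin_cases i
    · exact ⟨0, rfl⟩
    · exact ⟨1, rfl⟩
    · exact absurd rfl hi
  -- the blocks `{T₁}` (true) and `{T₀, E'}` (false)
  let κb : Fin 3 → Bool := fun i => decide (i = 1)
  -- (c) the block `{T₀, E'}`: the curve is absorbed by `T₀`, rank `4`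
  have hX : cmFamilyRank (fun i : {i : Fin 3 // κb i = false} => Φf i.1) = 4 := by
    have h := cmFamilyRank_comp_eq_of_quadratic_slot_of_odd (fun i : {i : Fin 3 // κb i = false} => Φf i.1) (i₀ := ⟨2, by decide⟩) h2f
      (fun _ : Fin 1 => (⟨0, by decide⟩ : {i : Fin 3 // κb i = false})) (fun i hi => ?_) 0 i₀ hodd
    · rw [← h]
      have h1 := cmFamilyRank_eq_of_isNondegenerate_of_unique (K := fun _ : Fin 1 => K₀) (fun _ : Fin 1 => Φ₀) hnd₀
      rw [h6₀] at h1
      exact h1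
    · obtain ⟨i, hi'⟩ := i
      fin_cases i
      · exact ⟨0, rfl⟩
      · exact absurd hi' (by decide)
      · exact absurd rfl hi
  -- (d) the block `{T₁}`: rank `4`
  have hY : cmFamilyRank (fun i : {i : Fin 3 // κb i = true} => Φf i.1) = 4 := by
    letI : Unique {i : Fin 3 // κb i = true} := ⟨⟨⟨1, by decide⟩⟩, fun i => Subtype.ext (of_decide_eq_true i.2)⟩
    have h1 := cmFamilyRank_eq_of_isNondegenerate_of_unique (fun i : {i : Fin 3 // κb i = true} => Φf i.1) hnd₁
    rw [show Module.finrank ℚ (Kf (default : {i : Fin 3 // κb i = true}).1) = 6 from h6₁] at h1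
    exact h1
  -- (e) the rank equation over the two blocks: `7 + 2 = 4 + 4 + 1`
  have hadd : cmFamilyRank Φf + Fintype.card Bool = (∑ c : Bool, cmFamilyRank fun i : {i : Fin 3 // κb i = c} => Φf i.1) + 1 := by
    rw [Fintype.card_bool, Fintype.sum_bool, hX, hY, hrank]
  -- (f) glue
  cases N with
  | zero =>
    have hfun : (fun j => (![T₀, T₁, E'] : Fin 3 → AbelianVariety ℂ) (κ j)) = fun _ : Fin 0 => T₀ := funext fun j => j.elim0
    rw [hfun]
    exact hodgeConjectureFor_biproduct_const_of_dim_le_three hT₀ h3₀ 0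
  | succ N =>
    refine hodgeConjectureFor_biproduct_of_cmFamilyRank_fiber_add_card_eq κb (fun c => ?_) hadd hA (fun c J _ _ π => ?_) κ
    · cases c
      · exact ⟨0, by decide⟩
      · exact ⟨1, by decide⟩
    · cases c
      · -- the block `{T₀, E'}`: gen 31's G6 (any CM curve × any simple CM threefold)
        have key : ∀ i : Fin 3, κb i = false →
            (![T₀, T₁, E'] : Fin 3 → AbelianVariety ℂ) i = (![E', T₀] : Fin 2 → AbelianVariety ℂ) (if i = 0 then 1 else 0) := by
          intro i hi
          fin_cases i
          · rfl
          · exact absurd hi (by decide)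
          · rfl
        have hfun : (fun j => (![T₀, T₁, E'] : Fin 3 → AbelianVariety ℂ) (π j).1) =
            fun j => (![E', T₀] : Fin 2 → AbelianVariety ℂ) (if (π j).1 = 0 then 1 else 0) := funext fun j => key (π j).1 (π j).2
        rw [hfun]
        exact hodgeConjectureFor_of_isIsogenous_biproduct_comp_of_cmCurve_simpleThreefold_of_markman hW4 h2' h6₀ hE' hT₀ hS₀
          (fun j => if (π j).1 = 0 then 1 else 0) (AbelianVariety.IsIsogenous.refl _)
      · -- the block `{T₁}`: powers of `T₁`
        have hfun : (fun j => (![T₀, T₁, E'] : Fin 3 → AbelianVariety ℂ) (π j).1) = fun _ : J => T₁ :=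
          funext fun j => by rw [of_decide_eq_true (π j).2]; rfl
        rw [hfun]
        let ε : Fin (Fintype.card J) ≃ J := (Fintype.equivFin J).symm
        exact Domination.hodgeConjectureFor_of_avDominatedBy (hodgeConjectureFor_biproduct_const_of_dim_le_three hT₁ h3₁ (Fintype.card J))
          (Domination.AVDominatedBy.of_iso (biproduct.reindex ε fun _ : J => T₁).symm (Domination.AVDominatedBy.refl _))

omit [NumberField K₀] [IsCMField K₀] [NumberField K₁] [IsCMField K₁] [NumberField k'] [IsCMField k'] in
/-- Swapping the two threefolds: `⨁_j ![T₁, T₀, E′] (swap 0 1 (κ j)) = ⨁_j ![T₀, T₁, E′] (κ j)` (the families agree pointwise). [folklore] -/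
theorem biproduct_vec_threefolds_swap (κ : Fin N → Fin 3) :
    (fun j => (![T₁, T₀, E'] : Fin 3 → AbelianVariety ℂ) (Equiv.swap (0 : Fin 3) 1 (κ j))) = fun j => (![T₀, T₁, E'] : Fin 3 → AbelianVariety ℂ) (κ j) := by
  funext j
  generalize κ j = c
  fin_cases c
  · rfl
  · rfl
  · rfl

omit [NumberField K₀] [IsCMField K₀] [NumberField K₁] [IsCMField K₁] [NumberField k'] [IsCMField k'] in
/-- Moving the curve to the front: `⨁_j ![E′, T₀, T₁] (c (κ j)) = ⨁_j ![T₀, T₁, E′] (κ j)` for the cycle `c = (0 1 2) ↦ (1 2 0)`. [folklore] -/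
theorem biproduct_vec_curve_front (κ : Fin N → Fin 3) :
    (fun j => (![E', T₀, T₁] : Fin 3 → AbelianVariety ℂ) ((![1, 2, 0] : Fin 3 → Fin 3) (κ j))) = fun j => (![T₀, T₁, E'] : Fin 3 → AbelianVariety ℂ) (κ j) := by
  funext j
  generalize κ j = c
  fin_cases c
  · rfl
  · rfl
  · rfl

/-! ## §2 Any two simple CM threefolds and any CM elliptic curve -/

/-- **MAIN THEOREM — ANY TWO SIMPLE CM THREEFOLDS AND ANY CM ELLIPTIC CURVE, given ONLY Markman's fourfold theorem.**  `T₀ ⊨ (K₀; Φ₀)`, `T₁ ⊨ (K₁; Φ₁)` SIMPLE abelian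
threefolds with CM by sextic CM fields, `E′ ⊨ (k′; Ψ′)` a CM elliptic curve — NOTHING assumed on the three fields, the types, or the relation between the
threefolds.  Then for every `κ : Fin N → Fin 3` — every `T₀^a × T₁^b × E′^c` — the Hodge conjecture holds for `⨁_j ![T₀, T₁, E′] (κ j)`, GIVEN ONLY
`Markman2025_weilClasses_algebraic_abelianFourfold`.  Cases on where `k′` embeds: in both fields (gen 31's G4), in neither (gen 33's S6), in exactly one (§1, by
curve absorption; the other by symmetry).  `HC_CM` is NOT asserted. [cite: MoonenZarhin1999LowDim, Thm. (0.1), Thm. (0.2), §3 (3.1), §5 (5.2)] [cite: Markman2025SurveySecant, Thm. 1.2]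
[cite: Gordon1999HodgeAVSurvey, §3 Theorem (proof), 7.5–7.7] [cite: Shimura1998, §18.1] -/
theorem hodgeConjectureFor_biproduct_comp_vec_of_any_two_simpleThreefolds_cmCurve_of_markman (hW4 : Markman2025_weilClasses_algebraic_abelianFourfold)
    (h6₀ : Module.finrank ℚ K₀ = 6) (h6₁ : Module.finrank ℚ K₁ = 6) (h2' : Module.finrank ℚ k' = 2) (hT₀ : IsCMTypeRealisation Φ₀ T₀ ι₀ θ₀)
    (hT₁ : IsCMTypeRealisation Φ₁ T₁ ι₁ θ₁) (hE' : IsCMTypeRealisation Ψ' E' ιE' θE') (hS₀ : T₀.IsSimple) (hS₁ : T₁.IsSimple) (κ : Fin N → Fin 3) :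
    HodgeConjectureFor (⨁ fun j => (![T₀, T₁, E'] : Fin 3 → AbelianVariety ℂ) (κ j)).dim (⨁ fun j => (![T₀, T₁, E'] : Fin 3 → AbelianVariety ℂ) (κ j)).X := by
  by_cases h₀ : IsEmpty (k' →+* K₀) <;> by_cases h₁ : IsEmpty (k' →+* K₁)
  · -- `k'` foreign to both fields: gen 33's S6
    have h3₀ : T₀.dim ≤ 3 := by rw [AndreProductForm.dim_eq_of_isCMTypeRealisation hT₀, h6₀]
    have h3₁ : T₁.dim ≤ 3 := by rw [AndreProductForm.dim_eq_of_isCMTypeRealisation hT₁, h6₁]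
    exact hodgeConjectureFor_biproduct_comp_vec_of_any_two_simple_dim_le_three_foreignCurve_of_markman hW4 hT₀ hT₁ hS₀ hS₁ h3₀ h3₁ h2' hE' h₀ h₁ κ
  · -- `k' ↪ K₁` only: §1 with the threefolds swapped
    obtain ⟨i₁⟩ := not_isEmpty_iff.1 h₁
    have h := hodgeConjectureFor_biproduct_comp_vec_of_two_simpleThreefolds_absorbedCurve_of_markman hW4 h6₁ h6₀ h2' hT₁ hT₀ hE' hS₁ hS₀ i₁ h₀
      (fun j => Equiv.swap (0 : Fin 3) 1 (κ j))
    rw [biproduct_vec_threefolds_swap κ] at h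
    exact h
  · -- `k' ↪ K₀` only: §1
    obtain ⟨i₀⟩ := not_isEmpty_iff.1 h₀
    exact hodgeConjectureFor_biproduct_comp_vec_of_two_simpleThreefolds_absorbedCurve_of_markman hW4 h6₀ h6₁ h2' hT₀ hT₁ hE' hS₀ hS₁ i₀ h₁ κ
  · -- `k'` in both fields: gen 31's G4
    obtain ⟨i₀⟩ := not_isEmpty_iff.1 h₀
    obtain ⟨i₁⟩ := not_isEmpty_iff.1 h₁
    have h := hodgeConjectureFor_biproduct_comp_vec_of_two_simpleThreefolds_of_markman hW4 h2' h6₀ h6₁ i₀ i₁ hE' hT₀ hT₁ hS₀ hS₁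
      (fun j => (![1, 2, 0] : Fin 3 → Fin 3) (κ j))
    rw [biproduct_vec_curve_front κ] at h
    exact h

/-- **`T₀ × T₁ × E′` itself**, for any two simple CM threefolds and any CM elliptic curve, given only Markman's fourfold theorem. [cite: MoonenZarhin1999LowDim, Thm. (0.1), (0.2)]
[cite: Markman2025SurveySecant, Thm. 1.2] -/
theorem hodgeConjectureFor_biproduct_vec_of_any_two_simpleThreefolds_cmCurve_of_markman (hW4 : Markman2025_weilClasses_algebraic_abelianFourfold)
    (h6₀ : Module.finrank ℚ K₀ = 6) (h6₁ : Module.finrank ℚ K₁ = 6) (h2' : Module.finrank ℚ k' = 2) (hT₀ : IsCMTypeRealisation Φ₀ T₀ ι₀ θ₀)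
    (hT₁ : IsCMTypeRealisation Φ₁ T₁ ι₁ θ₁) (hE' : IsCMTypeRealisation Ψ' E' ιE' θE') (hS₀ : T₀.IsSimple) (hS₁ : T₁.IsSimple) :
    HodgeConjectureFor (⨁ (![T₀, T₁, E'] : Fin 3 → AbelianVariety ℂ)).dim (⨁ (![T₀, T₁, E'] : Fin 3 → AbelianVariety ℂ)).X :=
  hodgeConjectureFor_biproduct_comp_vec_of_any_two_simpleThreefolds_cmCurve_of_markman hW4 h6₀ h6₁ h2' hT₀ hT₁ hE' hS₀ hS₁ (id : Fin 3 → Fin 3)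

/-- **Dominated form**: everything dominated by some `T₀^a × T₁^b × E′^c` (everything isogenous to such a product, every abelian subvariety or quotient of one), for any
two simple CM threefolds and any CM elliptic curve, given only Markman's fourfold theorem. [cite: MoonenZarhin1999LowDim, Thm. (0.1), (0.2)] [cite: Markman2025SurveySecant, Thm. 1.2]
[cite: MumfordAV1970, §19 Thm. 1 and p. 169] -/
theorem hodgeConjectureFor_of_avDominatedBy_comp_vec_of_any_two_simpleThreefolds_cmCurve_of_markman (hW4 : Markman2025_weilClasses_algebraic_abelianFourfold)
    (h6₀ : Module.finrank ℚ K₀ = 6) (h6₁ : Module.finrank ℚ K₁ = 6) (h2' : Module.finrank ℚ k' = 2) (hT₀ : IsCMTypeRealisation Φ₀ T₀ ι₀ θ₀)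
    (hT₁ : IsCMTypeRealisation Φ₁ T₁ ι₁ θ₁) (hE' : IsCMTypeRealisation Ψ' E' ιE' θE') (hS₀ : T₀.IsSimple) (hS₁ : T₁.IsSimple) (κ : Fin N → Fin 3)
    {X : AbelianVariety ℂ} (hX : Domination.AVDominatedBy X (⨁ fun j => (![T₀, T₁, E'] : Fin 3 → AbelianVariety ℂ) (κ j))) : HodgeConjectureFor X.dim X.X :=
  Domination.hodgeConjectureFor_of_avDominatedBy
    (hodgeConjectureFor_biproduct_comp_vec_of_any_two_simpleThreefolds_cmCurve_of_markman hW4 h6₀ h6₁ h2' hT₀ hT₁ hE' hS₀ hS₁ κ) hX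

/-- **Every abelian variety ISOGENOUS TO A PRODUCT OF COPIES of `T₀, T₁, E′`** (any finite index type), for any two simple CM threefolds and any CM elliptic curve, given
only Markman's fourfold theorem. [cite: MoonenZarhin1999LowDim, Thm. (0.1), (0.2)] [cite: Markman2025SurveySecant, Thm. 1.2] [cite: MumfordAV1970, §19] -/
theorem hodgeConjectureFor_of_isIsogenous_biproduct_comp_of_any_two_simpleThreefolds_cmCurve_of_markman (hW4 : Markman2025_weilClasses_algebraic_abelianFourfold)
    (h6₀ : Module.finrank ℚ K₀ = 6) (h6₁ : Module.finrank ℚ K₁ = 6) (h2' : Module.finrank ℚ k' = 2) (hT₀ : IsCMTypeRealisation Φ₀ T₀ ι₀ θ₀)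
    (hT₁ : IsCMTypeRealisation Φ₁ T₁ ι₁ θ₁) (hE' : IsCMTypeRealisation Ψ' E' ιE' θE') (hS₀ : T₀.IsSimple) (hS₁ : T₁.IsSimple) {J : Type} [Fintype J]
    (cls : J → Fin 3) {X : AbelianVariety ℂ} (hX : AbelianVariety.IsIsogenous X (⨁ fun j => (![T₀, T₁, E'] : Fin 3 → AbelianVariety ℂ) (cls j))) :
    HodgeConjectureFor X.dim X.X := by
  let ε : Fin (Fintype.card J) ≃ J := (Fintype.equivFin J).symm
  have e : (⨁ fun j => (![T₀, T₁, E'] : Fin 3 → AbelianVariety ℂ) (cls j)) ≅ ⨁ fun l => (![T₀, T₁, E'] : Fin 3 → AbelianVariety ℂ) (cls (ε l)) :=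
    (biproduct.reindex ε fun j => (![T₀, T₁, E'] : Fin 3 → AbelianVariety ℂ) (cls j)).symm
  exact hodgeConjectureFor_of_avDominatedBy_comp_vec_of_any_two_simpleThreefolds_cmCurve_of_markman hW4 h6₀ h6₁ h2' hT₀ hT₁ hE' hS₀ hS₁ (fun l => cls (ε l))
    (Domination.AVDominatedBy.of_isIsogenous hX (Domination.AVDominatedBy.of_iso e (Domination.AVDominatedBy.refl _)))

end TwoThreefoldsCurve

end Summit.HodgeConjecture.CorCM.MultiFieldWeil

end
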